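import Summits.CriticalPhenomena.PercolationContinuityZ3.Theorems.PercNearOneGluingNoHeavyLowerTailSahiLatinZeroBottomOneBlock

/-!
# `NoHeavyLowerTail` (crux stmt-CriticalPhenomena-4575), Sahi programme (prim-master-conj gen 52): **THE HALF-CORE THEOREM FOR EVERY
# BLOCK** — a `HalfCoreCert` exists for every nested pair of up-sets, so the grid invariant holds on EVERY half-core instance and
# TOP₁ with the sharp constant `3/2` holds on the whole half-core family

Support file (`--supports stmt-CriticalPhenomena-4575`; proofs only, no new definitions, no `sorry`, standard axioms).  Memo
`run/shared/lean/prim/prim-l12/FROM-prim-master-conj-g52-ONE-BLOCK.md`.  Nothing here asserts the crux, Kahn's conjecture or (C¼).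

THE MATHEMATICS.  `…ZeroBottomHalfCore` (gen 51) proved `HalfCoreCert S B L₁ L₂ M₁ M₂ → Grid4 (S×Ω) (B×Ω) (Ω×T) (Ω×Tᶜ)` for every block `V`
and every `T ⊆ [3]^V`, and `…ZeroBottomOneBlock` (gen 52) proved the two one-block lemmas (Jβ), (Jγ) for EVERY block `U`.  Here we put them
together: for the minimising admissible families the constants `L₁ = min coefA1`, `L₂ = min coefA2`, `M₁ = min coefB1`, `M₂ = min coefB2`
satisfy `L₁ + M₂ ≥ 0` (`coefA1_add_coefB2_nonneg`, from (Jβ)) and `L₂ + M₁ ≥ 0` (`coefA2_add_coefB1_nonneg`, from (Jγ)), so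
(`exists_halfCoreCert`) EVERY pair `(S, B)` with `S ∩ B = ∅` and `S ∪ B` an up-set carries a half-core certificate.  Consequences, for
every pair of finite blocks `U, V`, every nested pair of up-sets `S ⊆ S′` of `[3]^U` (indeed any `S ⊆ S′` with `S′` an up-set) and every
`T ⊆ [3]^V`:
* `grid4_halfCore_all` — the grid invariant `Grid4 (S×Ω) ((S′∖S)×Ω) (Ω×T) (Ω×Tᶜ)` (gen 50's conjecture (HC), all sizes);
* `isHalfCorePad_halfCore` — every half-core instance belongs to the certified family `IsHalfCorePad` (hence so do all its up-set factor
  lifts on either side), and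
* `three_kappa_top_le_two_kappa_lowerStep_halfCore` — TOP-SLICE DOMINANCE WITH THE SHARP CONSTANT `3/2` (`4c₁ ≥ 3c₃`, the lower-step form
  of (C¼)) for the zero-bottom data `P = S×Ω ⊂ P′ = S′×Ω`, `Q = Ω×T ⊂ Q′ = Ω` and every up-set `F ⊇ P ∪ Q`: an ARBITRARY prime/cut pair on
  one side (any number of coordinates, non-private cuts included) against a private cut on the other.
With gen 50's factor lemmas this covers all zero-bottom data `P′ = A_P × S′`, `P = A_P × S`, `Q′ = A_Q`, `Q = A_Q × T` with disjoint supports.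
HONEST LABEL: two general prime/cut pairs (both sides non-private beyond the window engine of gen 51), shared primes, (C¼), TOP₁ in general,
FBP(d ≥ 5) and Kahn remain OPEN. [this work]
-/

namespace Summit.CriticalPhenomena.PercolationContinuityZ3.Theorems.SahiLatin

open Finset

section halfcoreall
variable {U V : Type} [Fintype U] [DecidableEq U] [Fintype V] [DecidableEq V] (S B : Finset (Pt U))

/-- **`coefA1 + coefB2 ≥ 0`** on admissible families (from (Jβ) by three monotonicity steps). [this work] -/
theorem coefA1_add_coefB2_nonneg (hSB : Disjoint S B) (hS' : IsUpperSet ((S ∪ B : Finset (Pt U)) : Set (Pt U)))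
    {JSO JOO : Finset (Pt U)} (uSO : IsUpperSet (JSO : Set (Pt U))) (nOO : JOO ⊆ JSO) (hS : S ⊆ JSO)
    {JSS' JSO' JOS' : Finset (Pt U)} (uOS' : IsUpperSet (JOS' : Set (Pt U))) (n3 : JSO' ⊆ JSS') (n4 : JOS' ⊆ JSS') (hS2 : S ⊆ JSS') :
    0 ≤ coefA1 S B JSO JOO + coefB2 S B JSS' JSO' JOS' := by
  have hβ := oneBlock_beta S B hSB hS' uSO uOS' hS
  have e1 : nIn B JOO ≤ nIn B JSO := by
    unfold nIn; exact sum_le_sum_of_subset_of_nonneg nOO fun w _ _ => by positivity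
  have e2 : JSO ∩ S = S := inter_eq_right.2 hS
  have e3 : JSS' ∩ S = S := inter_eq_right.2 hS2
  have e4 : ((JSO' ∩ B).card : ℤ) ≤ (JSS' ∩ B).card := by exact_mod_cast card_le_card (inter_subset_inter n3 Subset.rfl)
  have e5 : ((JOS' ∩ B).card : ℤ) ≤ (JSS' ∩ B).card := by exact_mod_cast card_le_card (inter_subset_inter n4 Subset.rfl)
  have hX : (0 : ℤ) ≤ 2 ^ Fintype.card U := by positivity
  unfold coefA1 coefB2
  rw [e2, e3]
  nlinarith [mul_le_mul_of_nonneg_left e4 hX, mul_le_mul_of_nonneg_left e5 hX]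

/-- **`coefA2 + coefB1 ≥ 0`** on admissible families (from (Jγ) by monotonicity steps). [this work] -/
theorem coefA2_add_coefB1_nonneg (hSB : Disjoint S B) (hS' : IsUpperSet ((S ∪ B : Finset (Pt U)) : Set (Pt U)))
    {JSO JOO : Finset (Pt U)} (uSO : IsUpperSet (JSO : Set (Pt U))) (nOO : JOO ⊆ JSO) (hS : S ⊆ JSO)
    {JSS' JSO' JOS' JOO' : Finset (Pt U)} (uSO' : IsUpperSet (JSO' : Set (Pt U))) (uOS' : IsUpperSet (JOS' : Set (Pt U)))
    (n1 : JOO' ⊆ JSO') (n2 : JOO' ⊆ JOS') (n3 : JSO' ⊆ JSS') (n4 : JOS' ⊆ JSS') (hS2 : S ⊆ JSS') (hS3 : S ⊆ JSO') :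
    0 ≤ coefA2 S B JSO JOO + coefB1 S B JSS' JSO' JOS' JOO' := by
  have hγ := oneBlock_gamma S B hSB hS' uSO uSO' uOS' hS hS3 n1 n2
  have e1 : nIn B JOO ≤ nIn B JSO := by
    unfold nIn; exact sum_le_sum_of_subset_of_nonneg nOO fun w _ _ => by positivity
  have e2 : JSO ∩ S = S := inter_eq_right.2 hS
  have e3 : JSS' ∩ S = S := inter_eq_right.2 hS2
  have e3' : JSO' ∩ S = S := inter_eq_right.2 hS3
  have e4 : (((JSO' ∪ JOS') ∩ B).card : ℤ) ≤ (JSS' ∩ B).card := by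
    exact_mod_cast card_le_card (inter_subset_inter (union_subset n3 n4) Subset.rfl)
  have hX : (0 : ℤ) ≤ 2 ^ Fintype.card U := by positivity
  unfold coefA2 coefB1
  rw [e2, e3, e3']
  nlinarith [mul_le_mul_of_nonneg_left e4 hX]

/-- **A HALF-CORE CERTIFICATE EXISTS FOR EVERY `(S, B)`** with `S ∩ B = ∅` and `S ∪ B` an up-set (constants = minima of the coefficient
functionals over the admissible families). [this work] -/
theorem exists_halfCoreCert (hSB : Disjoint S B) (hS' : IsUpperSet ((S ∪ B : Finset (Pt U)) : Set (Pt U))) :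
    ∃ L₁ L₂ M₁ M₂ : ℤ, HalfCoreCert S B L₁ L₂ M₁ M₂ := by
  have uU : IsUpperSet (((univ : Finset (Pt U))) : Set (Pt U)) := by rw [coe_univ]; exact isUpperSet_univ
  -- admissible families as finite subtypes (no decidability needed)
  haveI neA : Nonempty {p : Finset (Pt U) × Finset (Pt U) //
      IsUpperSet (p.1 : Set (Pt U)) ∧ IsUpperSet (p.2 : Set (Pt U)) ∧ p.2 ⊆ p.1 ∧ S ⊆ p.1} :=
    ⟨⟨(univ, univ), uU, uU, Subset.rfl, subset_univ _⟩⟩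
  haveI neB : Nonempty {q : Finset (Pt U) × Finset (Pt U) × Finset (Pt U) × Finset (Pt U) //
      IsUpperSet (q.1 : Set (Pt U)) ∧ IsUpperSet (q.2.1 : Set (Pt U)) ∧ IsUpperSet (q.2.2.1 : Set (Pt U)) ∧ IsUpperSet (q.2.2.2 : Set (Pt U)) ∧
      q.2.2.2 ⊆ q.2.1 ∧ q.2.2.2 ⊆ q.2.2.1 ∧ q.2.1 ⊆ q.1 ∧ q.2.2.1 ⊆ q.1 ∧ S ⊆ q.1 ∧ S ⊆ q.2.1} :=
    ⟨⟨(univ, univ, univ, univ), uU, uU, uU, uU, Subset.rfl, Subset.rfl, Subset.rfl, Subset.rfl, subset_univ _, subset_univ _⟩⟩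
  obtain ⟨⟨a1, a1u1, a1u2, a1n, a1S⟩, hm1⟩ := Finite.exists_min fun p : {p : Finset (Pt U) × Finset (Pt U) //
      IsUpperSet (p.1 : Set (Pt U)) ∧ IsUpperSet (p.2 : Set (Pt U)) ∧ p.2 ⊆ p.1 ∧ S ⊆ p.1} => coefA1 S B p.1.1 p.1.2
  obtain ⟨⟨a2, a2u1, a2u2, a2n, a2S⟩, hm2⟩ := Finite.exists_min fun p : {p : Finset (Pt U) × Finset (Pt U) //
      IsUpperSet (p.1 : Set (Pt U)) ∧ IsUpperSet (p.2 : Set (Pt U)) ∧ p.2 ⊆ p.1 ∧ S ⊆ p.1} => coefA2 S B p.1.1 p.1.2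
  obtain ⟨⟨b1, b1u1, b1u2, b1u3, b1u4, b1n1, b1n2, b1n3, b1n4, b1S, b1S'⟩, hn1⟩ := Finite.exists_min
    fun q : {q : Finset (Pt U) × Finset (Pt U) × Finset (Pt U) × Finset (Pt U) //
      IsUpperSet (q.1 : Set (Pt U)) ∧ IsUpperSet (q.2.1 : Set (Pt U)) ∧ IsUpperSet (q.2.2.1 : Set (Pt U)) ∧ IsUpperSet (q.2.2.2 : Set (Pt U)) ∧
      q.2.2.2 ⊆ q.2.1 ∧ q.2.2.2 ⊆ q.2.2.1 ∧ q.2.1 ⊆ q.1 ∧ q.2.2.1 ⊆ q.1 ∧ S ⊆ q.1 ∧ S ⊆ q.2.1} => coefB1 S B q.1.1 q.1.2.1 q.1.2.2.1 q.1.2.2.2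
  obtain ⟨⟨b2, b2u1, b2u2, b2u3, b2u4, b2n1, b2n2, b2n3, b2n4, b2S, b2S'⟩, hn2⟩ := Finite.exists_min
    fun q : {q : Finset (Pt U) × Finset (Pt U) × Finset (Pt U) × Finset (Pt U) //
      IsUpperSet (q.1 : Set (Pt U)) ∧ IsUpperSet (q.2.1 : Set (Pt U)) ∧ IsUpperSet (q.2.2.1 : Set (Pt U)) ∧ IsUpperSet (q.2.2.2 : Set (Pt U)) ∧
      q.2.2.2 ⊆ q.2.1 ∧ q.2.2.2 ⊆ q.2.2.1 ∧ q.2.1 ⊆ q.1 ∧ q.2.2.1 ⊆ q.1 ∧ S ⊆ q.1 ∧ S ⊆ q.2.1} => coefB2 S B q.1.1 q.1.2.1 q.1.2.2.1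
  refine ⟨coefA1 S B a1.1 a1.2, coefA2 S B a2.1 a2.2, coefB1 S B b1.1 b1.2.1 b1.2.2.1 b1.2.2.2, coefB2 S B b2.1 b2.2.1 b2.2.2.1,
    ?_, ?_, ?_, ?_⟩
  · intro JSO JOO u1 u2 n h
    exact ⟨hm1 ⟨(JSO, JOO), u1, u2, n, h⟩, hm2 ⟨(JSO, JOO), u1, u2, n, h⟩⟩
  · intro JSS JSO JOS JOO u1 u2 u3 u4 n1 n2 n3 n4 f1 f2
    exact ⟨coefB0_nonneg S B hSB hS' u3 n2 n3 n4, hn1 ⟨(JSS, JSO, JOS, JOO), u1, u2, u3, u4, n1, n2, n3, n4, f1, f2⟩,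
      hn2 ⟨(JSS, JSO, JOS, JOO), u1, u2, u3, u4, n1, n2, n3, n4, f1, f2⟩⟩
  · exact coefA1_add_coefB2_nonneg S B hSB hS' a1u1 a1n a1S b2u3 b2n3 b2n4 b2S
  · exact coefA2_add_coefB1_nonneg S B hSB hS' a2u1 a2n a2S b1u2 b1u3 b1n1 b1n2 b1n3 b1n4 b1S b1S'

/-- **THE HALF-CORE THEOREM, EVERY BLOCK** (gen 50's conjecture (HC)): for `S ∩ B = ∅` with `S ∪ B` an up-set of `[3]^U` and ANY `T ⊆ [3]^V`,
the grid invariant `Grid4 (S×Ω) (B×Ω) (Ω×T) (Ω×Tᶜ)` holds. [this work] -/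
theorem grid4_halfCore_all (hSB : Disjoint S B) (hS' : IsUpperSet ((S ∪ B : Finset (Pt U)) : Set (Pt U))) (T : Finset (Pt V)) :
    Grid4 (cylL S : Finset (Pt (U ⊕ V))) (cylL B) (cylR T) (cylR Tᶜ) := by
  obtain ⟨L₁, L₂, M₁, M₂, hc⟩ := exists_halfCoreCert S B hSB hS'
  exact grid4_halfCore S B T hc

/-- Every half-core instance lies in the certified family `IsHalfCorePad` (so do its up-set factor lifts, by the family's constructors). [this work] -/
theorem isHalfCorePad_halfCore (hSB : Disjoint S B) (hS' : IsUpperSet ((S ∪ B : Finset (Pt U)) : Set (Pt U))) (T : Finset (Pt V)) :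
    IsHalfCorePad (U ⊕ V) (cylL S) (cylL B) (cylR T) (cylR Tᶜ) := by
  obtain ⟨L₁, L₂, M₁, M₂, hc⟩ := exists_halfCoreCert S B hSB hS'
  exact IsHalfCorePad.hcore S B T L₁ L₂ M₁ M₂ hSB hc

/-- **TOP-SLICE DOMINANCE WITH THE SHARP CONSTANT `3/2` ON EVERY HALF-CORE INSTANCE**: for `S ∩ B = ∅` with `S ∪ B` an up-set of
`[3]^U`, any `T ⊆ [3]^V` and every up-set `F ⊇ (S×Ω) ∪ (Ω×T)`,
`3·κ(F, (S∪B)×Ω, Ω) ≤ 2·κ(F×[3], lower step (S×Ω ⊂ (S∪B)×Ω), lower step (Ω×T ⊂ Ω))` — i.e. `4c₁ ≥ 3c₃` for an ARBITRARY prime/cut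
pair on one side against a private cut on the other, in every dimension. [this work] -/
theorem three_kappa_top_le_two_kappa_lowerStep_halfCore (hSB : Disjoint S B) (hS' : IsUpperSet ((S ∪ B : Finset (Pt U)) : Set (Pt U)))
    (T : Finset (Pt V)) {F : Finset (Pt (U ⊕ V))} (hF : IsUpperSet (F : Set (Pt (U ⊕ V))))
    (hPQ : (cylL S : Finset (Pt (U ⊕ V))) ∪ cylR T ⊆ F) :
    3 * kappa F ((cylL S : Finset (Pt (U ⊕ V))) ∪ cylL B) ((cylR T : Finset (Pt (U ⊕ V))) ∪ cylR Tᶜ) ≤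
      2 * kappa (ofSections F F F) (ofSections (cylL S) (cylL S) ((cylL S : Finset (Pt (U ⊕ V))) ∪ cylL B))
        (ofSections (cylR T) (cylR T) ((cylR T : Finset (Pt (U ⊕ V))) ∪ cylR Tᶜ)) :=
  three_kappa_top_le_two_kappa_lowerStep_of_isHalfCorePad (isHalfCorePad_halfCore S B hSB hS' T) hF hPQ

/-- The same for a nested pair `S ⊆ S′` with `S′` an up-set (`B = S′ ∖ S`): `Grid4 (S×Ω) ((S′∖S)×Ω) (Ω×T) (Ω×Tᶜ)`. [this work] -/
theorem grid4_halfCore_of_subset {S S' : Finset (Pt U)} (hSS' : S ⊆ S') (hS' : IsUpperSet ((S' : Finset (Pt U)) : Set (Pt U)))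
    (T : Finset (Pt V)) : Grid4 (cylL S : Finset (Pt (U ⊕ V))) (cylL (S' \ S)) (cylR T) (cylR Tᶜ) := by
  have h1 : Disjoint S (S' \ S) := disjoint_sdiff
  have h2 : IsUpperSet ((S ∪ (S' \ S) : Finset (Pt U)) : Set (Pt U)) := by rwa [union_sdiff_of_subset hSS']
  exact grid4_halfCore_all S (S' \ S) h1 h2 T

end halfcoreall

end Summit.CriticalPhenomena.PercolationContinuityZ3.Theorems.SahiLatin
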